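import Summits.HodgeConjecture.HodgeConjecture.Theorems.NikulinTwinTransportLefschetzOneOneK3Zigzag

/-!
# Route NikulinTwinTransport — `LefschetzOneOneK3`, `∂∂̄`–exponential line: zigzag data on the sets of a chart-convex cover

Helper file for the route item `LefschetzOneOneK3`: the local existence statements of
`NikulinTwinTransportLefschetzOneOneK3Zigzag.lean` (real primitives, `∂̄`-primitives, constancy)
transported to the sets `U_i`, `U_i ∩ U_j`, `U_i ∩ U_j ∩ U_k` of a chart-convex cover
(`Literature.NumberTheory.Transcendental.ChartConvexCover`), each of which is EMPTY or the chart
set of an open convex set; plus small conversions (functions versus `0`-forms, Čech sets of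
`1`-, `2`-, `3`-tuples).
-/

noncomputable section

open scoped Manifold ContDiff Topology ComplexConjugate
open Set Filter
open Literature.Geometry.Kaehler
open Literature.NumberTheory.Transcendental

namespace Summit.HodgeConjecture.HodgeConjecture.Theorems

/-! ### Small conversions -/

section Conversions

variable {E : Type} [NormedAddCommGroup E] [NormedSpace ℂ E]
  {M : Type} [TopologicalSpace M] [ChartedSpace E M]

/-- A function whose `0`-form is smooth at `x` is `C^∞` at `x` (boundaryless real model).
[cite: WarnerGTM94, 2.15] -/
theorem contMDiffAt_of_smoothAt_ofFun {F : Type*} [NormedAddCommGroup F] [NormedSpace ℝ F]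
    {f : M → F} {x : M} (hf : (MForm.ofFun 𝓘(ℝ, E) f).SmoothAt x) :
    ContMDiffAt 𝓘(ℝ, E) 𝓘(ℝ, F) ∞ f x := by
  have h := (MForm.smoothAt_ofFun_iff (I := 𝓘(ℝ, E)) f x).1 hf
  rw [ModelWithCorners.Boundaryless.range_eq_univ, contDiffWithinAt_univ] at h
  rw [contMDiffAt_iff]
  refine ⟨?_, ?_⟩
  · have h1 : ContinuousAt (f ∘ (extChartAt 𝓘(ℝ, E) x).symm) (extChartAt 𝓘(ℝ, E) x x) :=
      h.continuousAt
    have h3 := h1.comp (continuousAt_extChartAt (I := 𝓘(ℝ, E)) x)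
    refine h3.congr ?_
    filter_upwards [extChartAt_source_mem_nhds (I := 𝓘(ℝ, E)) x] with y hy
    simp only [Function.comp_apply]
    rw [(extChartAt 𝓘(ℝ, E) x).left_inv hy]
  · simpa only [extChartAt_model_space_eq_id, PartialEquiv.refl_coe, Function.id_comp,
      ModelWithCorners.Boundaryless.range_eq_univ, contDiffWithinAt_univ] using h

/-- The `0`-form of a constant function is smooth. [folklore] -/
theorem smoothAt_ofFun_const {F : Type*} [NormedAddCommGroup F] [NormedSpace ℝ F] (a : F) (x : M) :
    (MForm.ofFun 𝓘(ℝ, E) fun _ : M ↦ a).SmoothAt x :=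
  MForm.smoothAt_ofFun_of_contMDiffAt contMDiffAt_const

/-- The `0`-form of `f − a` (real, cast to `ℂ`) is that of `f` minus that of the constant `a`.
[folklore] -/
theorem ofFun_sub_const (f : M → ℝ) (a : ℝ) :
    (MForm.ofFun 𝓘(ℝ, E) fun y ↦ ((f y - a : ℝ) : ℂ)) =
      (MForm.ofFun 𝓘(ℝ, E) fun y ↦ ((f y : ℝ) : ℂ)) - MForm.ofFun 𝓘(ℝ, E) fun _ : M ↦ ((a : ℝ) : ℂ) := by
  funext x; ext v; simp [MForm.ofFun_apply]

/-- The `0`-form of `f + g − h` (real, cast to `ℂ`). [folklore] -/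
theorem ofFun_add_sub (f g h : M → ℝ) :
    (MForm.ofFun 𝓘(ℝ, E) fun y ↦ ((f y + g y - h y : ℝ) : ℂ)) =
      (MForm.ofFun 𝓘(ℝ, E) fun y ↦ ((f y : ℝ) : ℂ)) + (MForm.ofFun 𝓘(ℝ, E) fun y ↦ ((g y : ℝ) : ℂ)) -
        MForm.ofFun 𝓘(ℝ, E) fun y ↦ ((h y : ℝ) : ℂ) := by
  funext x; ext v; simp [MForm.ofFun_apply]

omit [TopologicalSpace M] in
/-- Single, double and triple intersections of a cover as Čech sets. [folklore] -/
theorem cechSet_one {ι : Type*} (U : ι → Set M) (i : ι) : cechSet U (fun _ : Fin 1 ↦ i) = U i := by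
  ext x; simp [mem_cechSet_iff]

omit [TopologicalSpace M] in
/-- Double intersections as Čech sets. [folklore] -/
theorem cechSet_two {ι : Type*} (U : ι → Set M) (i j : ι) : cechSet U ![i, j] = U i ∩ U j := by
  ext x; simp [mem_cechSet_iff, Fin.forall_fin_two]

omit [TopologicalSpace M] in
/-- Triple intersections as Čech sets. [folklore] -/
theorem cechSet_three {ι : Type*} (U : ι → Set M) (i j k : ι) :
    cechSet U ![i, j, k] = U i ∩ U j ∩ U k := by
  ext x
  simp only [mem_cechSet_iff, Fin.forall_fin_succ, Set.mem_inter_iff]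
  simp [and_assoc]

end Conversions


/-! ### The zigzag data on the sets of a chart-convex cover (empty or chart sets) -/

section Wrappers

variable {E : Type} [NormedAddCommGroup E] [NormedSpace ℂ E] [FiniteDimensional ℂ E]
  {M : Type} [TopologicalSpace M] [ChartedSpace E M] [IsManifold 𝓘(ℝ, E) ∞ M]

/-- `exists_real_primitive_one` on a set which is empty or a chart set of a convex open.
[cite: LeeSmoothManifolds2013, Thm. 17.14] -/
theorem exists_real_primitive_one' {U : Set M}
    (hU : U = ∅ ∨ ∃ (p : M) (C : Set E), IsOpen C ∧ Convex ℝ C ∧ C ⊆ (chartAt E p).target ∧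
      U = chartSet 𝓘(ℝ, E) p C)
    {θ : MForm 𝓘(ℝ, E) M ℂ 2} (hθs : IsSmoothForm θ) (hθc : IsClosedForm θ) (hθr : θ.conj = θ) :
    ∃ α : MForm 𝓘(ℝ, E) M ℂ 1, α ∈ smoothFormsOn 𝓘(ℝ, E) ℂ U 1 ∧ α.conj = α ∧
      ∀ x ∈ U, mextDeriv α x = θ x := by
  rcases hU with rfl | ⟨p, C, hC, hCc, hCt, rfl⟩
  · exact ⟨0, Submodule.zero_mem _, MForm.conj_zero, fun x hx ↦ absurd hx (notMem_empty x)⟩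
  · have hCT : C ⊆ (extChartAt 𝓘(ℝ, E) p).target := by rw [extChartAt_self]; exact hCt
    exact exists_real_primitive_one p hC hCc hCT (fun x _ ↦ (isSmoothForm_iff_smoothAt θ).1 hθs x)
      (fun x _ ↦ by rw [hθc]; rfl) hθr

/-- `exists_real_primitive_zero` on a set which is empty or a chart set of a convex open.
[cite: LeeSmoothManifolds2013, Thm. 17.14] -/
theorem exists_real_primitive_zero' {U : Set M}
    (hU : U = ∅ ∨ ∃ (p : M) (C : Set E), IsOpen C ∧ Convex ℝ C ∧ C ⊆ (chartAt E p).target ∧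
      U = chartSet 𝓘(ℝ, E) p C)
    {γ : MForm 𝓘(ℝ, E) M ℂ 1} (hγs : ∀ x ∈ U, γ.SmoothAt x) (hγc : ∀ x ∈ U, mextDeriv γ x = 0)
    (hγr : γ.conj = γ) :
    ∃ f : M → ℝ, (∀ x ∈ U, (MForm.ofFun 𝓘(ℝ, E) fun y ↦ ((f y : ℝ) : ℂ)).SmoothAt x) ∧
      ∀ x ∈ U, mextDeriv (MForm.ofFun 𝓘(ℝ, E) fun y ↦ ((f y : ℝ) : ℂ)) x = γ x := by
  rcases hU with rfl | ⟨p, C, hC, hCc, hCt, rfl⟩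
  · exact ⟨0, fun x hx ↦ absurd hx (notMem_empty x), fun x hx ↦ absurd hx (notMem_empty x)⟩
  · have hCT : C ⊆ (extChartAt 𝓘(ℝ, E) p).target := by rw [extChartAt_self]; exact hCt
    exact exists_real_primitive_zero p hC hCc hCT hγs hγc hγr

omit [FiniteDimensional ℂ E] in
/-- `exists_const_of_mextDeriv_eq_zero` on a set which is empty or a chart set of a convex open.
[cite: LeeSmoothManifolds2013, Prop. 17.6] -/
theorem exists_const_of_mextDeriv_eq_zero' {U : Set M}
    (hU : U = ∅ ∨ ∃ (p : M) (C : Set E), IsOpen C ∧ Convex ℝ C ∧ C ⊆ (chartAt E p).target ∧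
      U = chartSet 𝓘(ℝ, E) p C)
    {g : M → ℝ} (hgs : ∀ x ∈ U, (MForm.ofFun 𝓘(ℝ, E) fun y ↦ ((g y : ℝ) : ℂ)).SmoothAt x)
    (hdg : ∀ x ∈ U, mextDeriv (MForm.ofFun 𝓘(ℝ, E) fun y ↦ ((g y : ℝ) : ℂ)) x = 0) :
    ∃ c : ℝ, ∀ x ∈ U, g x = c := by
  rcases hU with rfl | ⟨p, C, hC, hCc, hCt, rfl⟩
  · exact ⟨0, fun x hx ↦ absurd hx (notMem_empty x)⟩
  · have hCT : C ⊆ (extChartAt 𝓘(ℝ, E) p).target := by rw [extChartAt_self]; exact hCt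
    exact exists_const_of_mextDeriv_eq_zero p hC hCc hCT hgs hdg

variable [T2Space M] [IsManifold 𝓘(ℂ, E) ω M]

/-- `exists_dolbeaultBar_primitive` on a set which is empty or a chart set of a convex open.
[cite: VoisinHodgeI2002, Prop. 2.36] -/
theorem exists_dolbeaultBar_primitive' {U : Set M}
    (hU : U = ∅ ∨ ∃ (p : M) (C : Set E), IsOpen C ∧ Convex ℝ C ∧ C ⊆ (chartAt E p).target ∧
      U = chartSet 𝓘(ℝ, E) p C)
    {α : MForm 𝓘(ℝ, E) M ℂ 1} (hα : α ∈ smoothFormsOn 𝓘(ℝ, E) ℂ U 1) {θ : MForm 𝓘(ℝ, E) M ℂ 2}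
    (hθ : IsOfType 1 1 θ) (hdα : ∀ x ∈ U, mextDeriv α x = θ x) :
    ∃ φ : M → ℂ, (∀ x ∈ U, (MForm.ofFun 𝓘(ℝ, E) φ).SmoothAt x) ∧
      ∀ x ∈ U, α.typeComponent 0 1 x = dolbeaultBar (MForm.ofFun 𝓘(ℝ, E) φ) x := by
  rcases hU with rfl | ⟨p, C, hC, hCc, hCt, rfl⟩
  · exact ⟨0, fun x hx ↦ absurd hx (notMem_empty x), fun x hx ↦ absurd hx (notMem_empty x)⟩
  · exact exists_dolbeaultBar_primitive p hC hCc hCt hα hθ hdα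

end Wrappers

end Summit.HodgeConjecture.HodgeConjecture.Theorems

end
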